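import Mathlib
import HarnessLib
import Summits.ResolutionOfSingularities.ResolutionOfSingularities.Theorems.WildQuotientsWildQuotientResolutionS1aKillCertCover
import Summits.ResolutionOfSingularities.ResolutionOfSingularities.Theorems.WildQuotientsWildQuotientResolutionS1aKillGlueSupp

/-!
# S1a — A PRINCIPAL CENTRE ON A REGULAR MODEL FROM A CERTIFICATE COVER (support inside `B`; no badness / Noetherian-base hypotheses)

[OURS · L1 W4.5c · lead-1 g10; FRAME-STATUS rev11 (F6) — the form of the K cover theorem (p639213) usable at EXPLICIT models] — NOT statements of the
manuscript; counted 0; AI-level work, weaker than expert review. Crux stmt-ResolutionOfSingularities-17941 `CyclicQuotientFourfolds`, line `s1a-logminvertex`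
v10, K-side. Route-independent.

* ★★ `GameFrame.GModel.exists_isPrincipalCentre_supp_le_of_certCover` — regular separated model, `g₀ ^ p = 1`; finitely many stable affine charts with weighted
  centres in `Γ(M.V, O_i)` carrying cobordant kill certificates (KC), agreement of the extended weighted filtrations on common affine opens, a closed `B` covered
  by the charts containing `V(f_i) ∩ O_i` ⇒ `∃ 𝒦 d, IsPrincipalCentre p M.act g₀ 𝒦 d ∧ supp 𝒦_d ⊆ B ∧ every O_i a principal-centre chart`.
-/

set_option linter.dupNamespace false

noncomputable section

universe u v

open CategoryTheory Limits AlgebraicGeometry TopologicalSpace Topology Opposite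
open Literature.AlgebraicGeometry.Resolution Literature.AlgebraicGeometry.RelativeSpec
open Summit.ResolutionOfSingularities.ResolutionOfSingularities.Theorems.WildQuotientResolution.S1
open Summit.ResolutionOfSingularities.ResolutionOfSingularities.Theorems.WildQuotientResolution.S1.NodeAtlas
open Summit.ResolutionOfSingularities.ResolutionOfSingularities.Theorems.WildQuotientResolution.S1.ProducerStep
open Summit.ResolutionOfSingularities.ResolutionOfSingularities.Theorems.WildQuotientResolution.S1.CoarseChart
open Summit.ResolutionOfSingularities.ResolutionOfSingularities.Theorems.WildQuotientResolution.S1.ChartData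
open Summit.ResolutionOfSingularities.ResolutionOfSingularities.Theorems.WildQuotientResolution.S1.KillGlue
open Summit.ResolutionOfSingularities.ResolutionOfSingularities.Theorems.WildQuotientResolution.S1.KillCert

namespace Summit.ResolutionOfSingularities.ResolutionOfSingularities.Theorems.WildQuotientResolution.S1.GameFrame.GModel

open GoodCharts

variable {p : ℕ} {X' X₁ : Scheme.{0}} {q : X' ⟶ X₁} {G : Type} [Group G] {ρ : G →* Aut X'} {g₀ : G}

set_option maxHeartbeats 800000 in
/-- ★★ **A PRINCIPAL CENTRE ON A REGULAR MODEL FROM A CERTIFICATE COVER, SUPPORT INSIDE `B`** — `exists_isPrincipalCentre_touch_of_certCover` (p639213) WITHOUT the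
hypotheses `B ⊆ Z(M)`, `B` non-empty, Noetherian base: the conclusion is a principal centre (a legal kill move) with `supp ⊆ B` for which every `O_i` is a
principal-centre chart. The form for EXPLICIT regular models (initial models of linear actions), where the certificate side is pure algebra and badness of
`B` is not needed. [OURS · L1 W4.5c · FRAME-STATUS rev11 (F6); NOT a statement of the manuscript] -/
theorem exists_isPrincipalCentre_supp_le_of_certCover [Finite G] (hG : ∀ g : G, g ∈ Subgroup.zpowers g₀) (hg₀ : g₀ ^ p = 1)
    (M : GModel p q G ρ g₀) [M.V.IsSeparated] (hreg : Scheme.IsRegular M.V)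
    {ι : Type} [Finite ι] (O : ι → M.act.StableAffineOpens) (hO : ∀ i, IsAffineOpen (O i).1)
    (c : ι → ℕ) (f : ∀ i, Fin (c i) → Γ(M.V, (O i).1)) (w : ∀ i, Fin (c i) → ℕ) (hc : ∀ i, 0 < c i) (hw : ∀ i k, 0 < w i k)
    (hK1 : ∀ i, RingTheory.Sequence.IsRegular Γ(M.V, (O i).1) (List.ofFn (f i)))
    (hK1' : ∀ i, IsRegularRing (Γ(M.V, (O i).1) ⧸ Ideal.span (Set.range (f i))))
    (hσJ : ∀ i (n : ℕ), ((weightedFiltration (f i) (w i)).ideal n).map (actOEquiv M.act (O i) g₀ : Γ(M.V, (O i).1) →+* Γ(M.V, (O i).1)) ≤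
      (weightedFiltration (f i) (w i)).ideal n)
    (hcert : ∀ i (hp' : 0 < p) (hσp : ∀ x, (⇑(actOEquiv M.act (O i) g₀))^[p] x = x),
      ∃ g, CobordantKillCert (f i) (w i) (actOEquiv M.act (O i) g₀) (hσJ i) hp' hσp g)
    (hagree : ∀ i j (U : M.V.affineOpens) (hi : U.1 ≤ (O i).1) (hj : U.1 ≤ (O j).1) (n : ℕ),
      ((weightedFiltration (f i) (w i)).ideal n).map (M.V.presheaf.map (homOfLE hi).op).hom =
        ((weightedFiltration (f j) (w j)).ideal n).map (M.V.presheaf.map (homOfLE hj).op).hom)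
    {B : Set M.V} (hBc : IsClosed B) (hBcov : B ⊆ ⋃ i, ((O i).1 : Set M.V))
    (hsupp : ∀ i, M.V.zeroLocus (U := (O i).1) (Set.range (f i)) ∩ ((O i).1 : Set M.V) ⊆ B) :
    ∃ (𝒦 : ReesFiltration M.V) (d : ℕ), IsPrincipalCentre p M.act g₀ 𝒦 d ∧ (((𝒦.ideal d).support : Set M.V)) ⊆ B ∧
      ∀ i, IsPrincipalCentreChart p M.act g₀ 𝒦 d (O i) := by
  classical
  haveI : IsLocallyNoetherian M.V := M.isLocallyNoetherian
  haveI : Fintype ι := Fintype.ofFinite ι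
  -- the trivial node on each chart
  have hnode : ∀ i, ∃ (𝒜 : (Π j : Fin 0, ZMod ((![] : Fin 0 → ℕ) j)) → AddSubgroup Γ(M.V, (O i).1)) (_ : GradedRing 𝒜),
      (∀ e, 𝒜 e = ⊤) ∧ ∃ e : Γ(M.V, (O i).1) ≃+* ↥(𝒜 0), ∀ b, ((e b : ↥(𝒜 0)) : Γ(M.V, (O i).1)) = b :=
    fun i => exists_trivialGradedRing _ _
  choose 𝒜 gr h𝒜 e he using hnode
  -- Veronese degrees, and a common one
  have hver₀ : ∀ i, ∃ d : ℕ, letI := gr i; VeroneseNormalised (𝒜 i) (f i) (w i) d := by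
    intro i
    letI := gr i
    refine Veronese.veroneseNormalisation _ _ (𝒜 i) ⟨∅, ?_⟩ (c i) (f i) (fun _ => 0) (w i) (fun k => by rw [h𝒜 i]; trivial)
    rw [h𝒜 i 0, Finset.coe_empty, Set.union_empty]
    exact top_le_iff.mp fun x _ => Subring.subset_closure trivial
  choose d hd using hver₀
  let D : ℕ := ∏ i, d i
  have hdpos : ∀ i, 0 < d i := fun i => by letI := gr i; exact (hd i).1
  have hD : ∀ i, letI := gr i; VeroneseNormalised (𝒜 i) (f i) (w i) D := by
    intro i
    letI := gr i
    have e1 : D = d i * ∏ j ∈ Finset.univ.erase i, d j := (Finset.mul_prod_erase Finset.univ d (Finset.mem_univ i)).symm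
    rw [e1]
    exact CoarseChart.veroneseNormalised_mul (𝒜 i) (f i) (w i) (hd i) (Finset.prod_pos fun j _ => hdpos j)
  have hDpos : 0 < D := Finset.prod_pos fun j _ => hdpos j
  -- the chart filtrations
  let K : ∀ i, IdealFiltration Γ(M.V, (O i).1) := fun i => weightedFiltration (f i) (w i)
  let 𝒦 : ι → ReesFiltration M.V := fun i => chartFiltration (O i).1 (K i)
  have h𝒦O : ∀ i n, ((𝒦 i).filtration ⟨(O i).1, hO i⟩).ideal n = (weightedFiltration (f i) (w i)).ideal n := fun i n =>
    filtration_chartFiltration (O i).1 (hO i) (K i) n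
  have h𝒦O' : ∀ i n, ((𝒦 i).filtration ⟨(O i).1, hO i⟩).ideal n =
      (letI := gr i; ((traceFiltration (𝒜 i) (f i) (w i)).ideal n).comap ((e i : Γ(M.V, (O i).1) →+* ↥(𝒜 i 0)))) := by
    intro i n
    letI := gr i
    rw [h𝒦O]
    ext t
    rw [Ideal.mem_comap, mem_traceFiltration_iff, RingHom.coe_coe, he]
  -- each chart is a principal-centre chart
  have hprin : ∀ i, IsPrincipalCentreChart p M.act g₀ (𝒦 i) D (O i) := by
    intro i
    letI := gr i
    haveI : IsNoetherianRing Γ(M.V, (O i).1) := IsLocallyNoetherian.component_noetherian ⟨(O i).1, hO i⟩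
    have hregi : IsRegularRing Γ(M.V, (O i).1) := hreg.isRegularRing_of_isAffineOpen (hO i)
    have hσp : ∀ x, (⇑(actOEquiv M.act (O i) g₀))^[p] x = x := fun x => actOEquiv_iterate_eq_self M.act (O i) hg₀ x
    have htame : IsTameNode p Γ(M.V, (O i).1) (𝒜 i) (actOEquiv M.act (O i) g₀) := by
      refine ⟨inferInstance, hregi, ?_, ?_, ?_, hσp⟩
      · exact ⟨∅, fun _ h => absurd h (Finset.notMem_empty _), inferInstance⟩
      · refine ⟨∅, eq_top_iff.mpr fun b _ => Subring.subset_closure (Or.inl ?_)⟩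
        rw [h𝒜 i 0]; exact AddSubgroup.mem_top b
      · intro d' b _; rw [h𝒜 i d']; exact AddSubgroup.mem_top _
    refine ⟨hO i, 0, ![], Γ(M.V, (O i).1), inferInstance, 𝒜 i, gr i, actOEquiv M.act (O i) g₀, e i, htame, fun t => ?_, c i, f i,
      fun _ => 0, w i, hc i, fun k => ?_, hw i, hK1 i, hK1' i, hσJ i, h𝒦O' i, hD i, ?_⟩
    · rw [he, he]; rfl
    · rw [h𝒜 i]; trivial
    · intro hp' hσp' d' b hb hσb hd'
      obtain ⟨g, hg⟩ := hcert i hp' hσp'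
      exact isPrincipal_augmentationIdeal_sigmaChart_of_cert (f i) (w i) _ (hσJ i) hp' hσp' (𝒜 i) hd' b hb hσb hg
  -- agreement on common affine opens
  have hagree' : ∀ i j (U : M.V.affineOpens), U.1 ≤ (O i).1 → U.1 ≤ (O j).1 →
      ∀ n, ((𝒦 i).filtration U).ideal n = ((𝒦 j).filtration U).ideal n := by
    intro i j U hi hj n
    have ei : ((𝒦 i).filtration U).ideal n = ((weightedFiltration (f i) (w i)).ideal n).map (M.V.presheaf.map (homOfLE hi).op).hom := by
      rw [← h𝒦O i n, ReesFiltration.filtration_ideal, ReesFiltration.filtration_ideal]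
      exact (((𝒦 i).ideal n).map_ideal (U := U) (V := ⟨(O i).1, hO i⟩) hi).symm
    have ej : ((𝒦 j).filtration U).ideal n = ((weightedFiltration (f j) (w j)).ideal n).map (M.V.presheaf.map (homOfLE hj).op).hom := by
      rw [← h𝒦O j n, ReesFiltration.filtration_ideal, ReesFiltration.filtration_ideal]
      exact (((𝒦 j).ideal n).map_ideal (U := U) (V := ⟨(O j).1, hO j⟩) hj).symm
    rw [ei, ej, hagree i j U hi hj n]
  -- supports inside `B`
  have hsupp' : ∀ i, ((((𝒦 i).ideal D).support : Set M.V)) ∩ ((O i).1 : Set M.V) ⊆ B := by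
    intro i x ⟨hx, hxO⟩
    have hZ : x ∈ M.V.zeroLocus (U := (O i).1) (((K i).ideal D : Ideal Γ(M.V, (O i).1)) : Set Γ(M.V, (O i).1)) :=
      (mem_support_chartFiltration_iff (O i).1 (hO i) (K i) D hxO).mp hx
    refine hsupp i ⟨?_, hxO⟩
    -- `V(𝒥_D) ⊆ V(I^D) = V(I) = V(range f)`
    have hID : Ideal.span (Set.range (f i)) ^ D ≤ (K i).ideal D := by
      have h1 : Ideal.span (Set.range (f i)) ≤ (K i).ideal 1 := by
        rw [Ideal.span_le]
        rintro _ ⟨k, rfl⟩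
        exact (weightedFiltration (f i) (w i)).antitone (hw i k) (mem_weightedFiltration_ideal (f i) (w i) k)
      refine (Ideal.pow_right_mono h1 D).trans ?_
      have := Veronese.idealFiltration_pow_le (K i) 1 D
      rwa [one_mul] at this
    have h2 : x ∈ M.V.zeroLocus (U := (O i).1) ((Ideal.span (Set.range (f i)) ^ D : Ideal Γ(M.V, (O i).1)) : Set Γ(M.V, (O i).1)) :=
      M.V.zeroLocus_mono (SetLike.coe_subset_coe.mpr hID) hZ
    rw [← Scheme.zeroLocus_radical, Ideal.radical_pow _ hDpos.ne', Scheme.zeroLocus_radical, Scheme.zeroLocus_span] at h2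
    exact h2
  obtain ⟨J, hJ, hJsupp, hJO⟩ := exists_isPrincipalCentre_of_agree_supp_le hG M O 𝒦 hDpos hprin hagree' hBc hBcov hsupp'
  exact ⟨J, D, hJ, hJsupp, hJO⟩


end Summit.ResolutionOfSingularities.ResolutionOfSingularities.Theorems.WildQuotientResolution.S1.GameFrame.GModel

end
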